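import Summits.BirchSwinnertonDyer.BirchSwinnertonDyer.Theses.EisensteinPrimes
import Literature.NumberTheory.EllipticCurves.SteinWuthrich2013.NonsplitMultCanonicalHolds
import HarnessLib

/-!
# Route `EisensteinPrimes` (rung K5): the aside item `SteinWuthrichMultCanonicalExists` CLOSED
# by the Literature discharge `SteinWuthrich2013.exists_isMultCanonical_holds`

Item stmt-BirchSwinnertonDyer-19475 (aside, rank 9; conjunct 19 of `PublishedInputs`,
stmt-BirchSwinnertonDyer-19037; the same ledger item is the support child
`SteinWuthrichMultCanonicalHeight` of routes `KolyvaginRoadThree` and `ClassRecordThree`) is, by name,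
the Literature constant `Literature.NumberTheory.EllipticCurves.SteinWuthrich2013.exists_isMultCanonical`
(Stein–Wuthrich 2013 §4.2: existence of the canonical `p`-adic height datum at a non-split
multiplicative prime `p ≠ 2`, formula (4.1)). That named fact is a THEOREM of the tree:
`SteinWuthrich2013.exists_isMultCanonical_holds`
(`Literature/NumberTheory/EllipticCurves/SteinWuthrich2013/NonsplitMultCanonicalHolds.lean`, cell
`bsd-eis` seat `k5-c4` g3, via `exists_isMultCanonical_of_theta_nonsplit`, Tate uniformisation over
`ℂ_p` and Silverman's theta relation `TateCurve.tate_thetaRelation`). This file only restates that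
theorem at the FULLY-QUALIFIED item type, so the ledger item closes `proved`; nothing is asserted,
no hypothesis.

Honest framing: closes ONE cite-only published input of rung K5 of `BirchSwinnertonDyer` (an aside
item of route `EisensteinPrimes`); no crux, no label or count of the cell's partition moves; BSD is
proved for no curve by this file. Cell `bsd-eis`, seat `bsd-eis-k5-ty` g14 (typer).
[cite: SteinWuthrich2013, §4.2 (pp. 15–16)] [cite: SilvermanATAEC1994, Prop. V.3.2 (b) (PDF p. 399)]
-/

set_option autoImplicit false
set_option linter.dupNamespace false

namespace Summit.BirchSwinnertonDyer.BirchSwinnertonDyer.Theorems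

/-- **Item `SteinWuthrichMultCanonicalExists` holds** (Stein–Wuthrich 2013 §4.2, non-split
multiplicative case: `∀ W p, p ≠ 2 → multiplicative, not split at p → ∀ q (Tate parameter),
∃ Dh, IsMultCanonical Dh q`), by the Literature theorem `SteinWuthrich2013.exists_isMultCanonical_holds`.
[cite: SteinWuthrich2013, §4.2 (pp. 15–16)] -/
theorem steinWuthrichMultCanonicalExists_holds :
    Summit.BirchSwinnertonDyer.BirchSwinnertonDyer.Theses.EisensteinPrimes.SteinWuthrichMultCanonicalExists :=
  Literature.NumberTheory.EllipticCurves.SteinWuthrich2013.exists_isMultCanonical_holds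

end Summit.BirchSwinnertonDyer.BirchSwinnertonDyer.Theorems
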